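import Summits.BirchSwinnertonDyer.BirchSwinnertonDyer.Theorems.EisensteinPrimesSplitMultSfTransfer
import HarnessLib

/-!
# Crux 4 `BSDpOnCellC` (stmt-BirchSwinnertonDyer-19034), line b1 — the SPLIT conjunct of the wall `stub_imprimitiveCount`:
# Keller–Yin's anomalous `λ`-inequality (Thm. 1.4.1 (iii), `≤` half, Cases I–III) at a SPLIT multiplicative Eisenstein prime
# IN LINE b1's CURRENCY — the imprimitivity set `Sf` = the places of `K` over `N_E` NOT over `p` (Keller–Yin §5.1: `S = Σ ∖ {v, v̄, ∞}`)

Cell `bsd-eis` (run/shared/lean/pub/bsd-eis/), width seat `bsd-line-x2-p2` gen 10 (`--supports -19034`, closes nothing; skeleton of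
record b1 v12 sha256 155e218d… UNCHANGED, W-79). Sequel of `…SplitMultLambdaLE` (p673406) and `…SplitMultSfTransfer` (this seat).

WHY. `SplitMultLambdaLE.lambdaInvariant_add_le_of_split` (the x1 V21 index road run at a split multiplicative datum) takes its imprimitivity
set in the x1 producers' convention `w ∈ Sf ↔ N_W ∈ w`, which at `p ∣ N` CONTAINS the places `v, v̄` over `p`; line b1's wall
`stub_imprimitiveCount` binds `Sf` by `w ∈ Sf ↔ (N_W ∈ w ∧ p ∉ w)`. By `SplitMultSfTransfer` no Selmer object of the road sees the difference
(every «outside `S`» condition is imposed at `w ∤ p` only): the dual `X_ac^{Sf}` and `X_ac^{Sf ∪ {v,v̄}}` are `Λ`-isomorphic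
(`xAc_invariants_congr`) and the Greenberg–Vatsal dual data transfer (`prop_datumDualData_congr_offP`). THIS FILE:
`lambdaInvariant_add_le_of_split_offP` — the same inequality with EVERY object over line b1's `Sf`.

HONEST FRAMING: helper theorems only (0 defs, 0 named facts introduced, 0 sorry); CONDITIONAL on the six named published facts it takes as
hypotheses (Greenberg 2016 Prop. 2.6.3; Greenberg 2006 Props. 4.1, 4.2, §5 A, 3.2; `cd_p(G_{K,Σ}) ≤ 2` — all already inputs of the x1 line / b1
chain); closes no stub; no summit statement / BSD / MC / IMC / KY Thm. 1.4.1 (iii) for any curve is proved here (the cotorsion clauses are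
hypotheses); 0 cells / labels / tiers move.

References: [KellerYin2024] §5.1 (TeX L1725–1735), Thm. 1.4.1 (iii), §1.3–§1.4 Cases I–III (arXiv:2402.12781v2); [Castella2018] Def. 2.2
(arXiv:1704.06608 p. 5); [GreenbergVatsal2000] §2 pp. 14–15, 20, 23; [Greenberg2016Selmer] Prop. 2.6.3; [Greenberg2006] Props. 3.2, 4.1, 4.2,
§5 A; [NeukirchSchmidtWingberg2008] (8.3.18); [SilvermanAEC2009] VII.§5, VIII.§1.
-/

set_option autoImplicit false
-- the route's Theorems namespace repeats the summit name by design (D-0017 nested layout)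
set_option linter.dupNamespace false

noncomputable section

open scoped Classical

namespace Summit.BirchSwinnertonDyer.BirchSwinnertonDyer.Theorems.SplitMultSfTransfer

open PowerSeries WeierstrassCurve NumberField IsDedekindDomain Field
  Literature.NumberTheory.GaloisRepresentations Literature.NumberTheory.EllipticCurves.GreenbergVatsal2000
  Literature.NumberTheory.EllipticCurves Literature.NumberTheory.EllipticCurves.Rank1Residual
  Literature.NumberTheory.EllipticCurves.Castella2018 Literature.NumberTheory.EllipticCurves.GreenbergSelmer
  Literature.NumberTheory.QuadraticFields Literature.NumberTheory.EllipticCurves.KellerYin2024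
  Literature.NumberTheory.EllipticCurves.IwasawaAlgebra Literature.NumberTheory.IwasawaTheory
  Literature.NumberTheory.IwasawaTheory.Greenberg2016 Literature.NumberTheory.IwasawaTheory.Greenberg2006
  Literature.NumberTheory.GaloisCohomology
  Summit.BirchSwinnertonDyer.Rank1Residual.X2.ResidualDevissageModules
  Summit.BirchSwinnertonDyer.BirchSwinnertonDyer.Theorems

/-! ## KY Thm. 1.4.1 (iii)'s `λ`-inequality at a SPLIT multiplicative prime in LINE b1's CURRENCY (`Sf` off `p`) -/

section LineB1

/-- `p ∣ N_W` at a split multiplicative prime, read as `N_W ∈ w` for every place `w ∋ p` of `K`. [cite: SilvermanAEC2009, VII.§5 and VIII.§1] -/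
theorem conductorNorm_mem_of_natCast_mem {K : Type} [Field K] [NumberField K] (W : WeierstrassCurve ℚ) [W.IsElliptic]
    [W.IsGloballyMinimal] {p : ℕ} [Fact p.Prime] (hsplitred : W.HasSplitMultiplicativeReductionAtPrime p)
    {w : HeightOneSpectrum (𝓞 K)} (hw : ((p : ℕ) : 𝓞 K) ∈ w.asIdeal) :
    ((W.conductorNorm ℤ : ℤ) : 𝓞 K) ∈ w.asIdeal := by
  have hbad : ¬ W.HasGoodReductionAtPrime p :=
    WeierstrassCurve.HasMultiplicativeReduction.not_hasGoodReduction (R := ℤ_[p]) hsplitred.hasMultiplicativeReductionAtPrime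
  obtain ⟨m, hm⟩ := (W.dvd_conductorNorm_iff_not_hasGoodReductionAtPrime p).mpr hbad
  rw [hm, Nat.cast_mul, Int.cast_mul, Int.cast_natCast]
  exact w.asIdeal.mul_mem_right _ hw

/-- **Keller–Yin's anomalous `λ`-inequality (Thm. 1.4.1 (iii), `≤` half) AT A SPLIT MULTIPLICATIVE EISENSTEIN PRIME IN LINE b1's CURRENCY**:
as `SplitMultLambdaLE.lambdaInvariant_add_le_of_split` (orientation (ω, 𝟙): `θsub` ramified at `v̄`; binders `W/ℚ` globally minimal, `2 < p`
SPLIT multiplicative, `K` imaginary quadratic with (Heeg) for `N_W` and `(p)` split, `E(K)[p] = 0`, `v` through `ι`, `v̄ ∋ p`, `v̄ ≠ v`, `κ`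
anticyclotomic with generator `γ`, residual pair `(θsub, θquot)`, dual data, cotorsion clauses; GRANTED the six named PUB facts), but with
EVERY object over line b1's imprimitivity set `Sf` — `w ∈ Sf ↔ (N_W ∈ w ∧ p ∉ w)`, the places over `N` NOT over `p` (KY §5.1
`S = Σ ∖ {v, v̄, ∞}`; the wall `stub_imprimitiveCount`'s binder): `λ(DSsub.X) + λ(DSquot.X) ≤ λ(𝔛^{Sf}_f) + [θquot = 𝟙]`. Proof: run the
`Sf ∪ {v, v̄}` statement and transfer every object by §1–§3 (the two sets agree off `p`).
[cite: KellerYin2024, Thm. 1.4.1 (iii), §1.3–§1.4 Cases I–III, §5.1 (arXiv:2402.12781v2 TeX L1087–1330, L1725–1769)]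
[cite: GreenbergVatsal2000, §2 pp. 14–15, 20] [cite: Greenberg2016Selmer, Prop. 2.6.3] [cite: Greenberg2006, Props. 3.2, 4.1, 4.2, §5 A]
[cite: NeukirchSchmidtWingberg2008, (8.3.18)] [cite: Castella2018, Def. 2.2] -/
theorem lambdaInvariant_add_le_of_split_offP (h263 : prop263_sur_of_crk) (h41 : prop41_globalEulerPoincareCorank)
    (h42 : prop42_localEulerPoincareCorank) (h5A : sec5A_localH2_subsingleton_of_LOC1)
    (h32 : prop32_cohomology_isCofinitelyGenerated)
    (W : WeierstrassCurve ℚ) [W.IsElliptic] [W.IsGloballyMinimal] (p : ℕ) [Fact p.Prime]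
    (hp : 2 < p) (hsplitred : W.HasSplitMultiplicativeReductionAtPrime p)
    (K : Type) [Field K] [NumberField K] (hK : IsImaginaryQuadratic K)
    (hCD2 : groupCdLE_two_galoisGroupUnramifiedOutside K)
    (hH : SatisfiesHeegnerHypothesis (W.conductorNorm ℤ) K)
    (hsplit : ((Ideal.span {(p : ℤ)}).primesOver (𝓞 K)).ncard = 2)
    (htor : ∀ Q : (W.baseChange K).toAffine.Point, p • Q = 0 → Q = 0)
    (ι : K →+* ℚ_[p]) (v vbar : HeightOneSpectrum (𝓞 K))
    (hv : ∀ x : 𝓞 K, x ∈ v.asIdeal ↔ ‖ι (x : K)‖ < 1)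
    (hvbar : ((p : ℕ) : 𝓞 K) ∈ vbar.asIdeal) (hne : vbar ≠ v)
    (κ : ZpExtension K p) (hκ : κ.IsAnticyclotomic)
    (γ : absoluteGaloisGroup K) [Fact (κ.IsTopGenerator γ)]
    (θsub θquot : FramedGaloisRep K (padicCoeffIntegers (∅ : Set (PadicAlgCl p))) 1)
    (hpair : IsResidualPairOver (W.baseChange K) p θsub θquot)
    (hramI : ∃ τ ∈ inertia vbar, unitChar θsub τ ≠ 1)
    (Sf : Finset (HeightOneSpectrum (𝓞 K)))
    (hSf : ∀ w : HeightOneSpectrum (𝓞 K), w ∈ Sf ↔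
      (((W.conductorNorm ℤ : ℤ) : 𝓞 K) ∈ w.asIdeal ∧ ((p : ℕ) : 𝓞 K) ∉ w.asIdeal))
    (DSsub : DatumDualData κ γ (charModule ∅ θsub)
        (AcSelmer.bdpData (charModule ∅ θsub) p vbar) (↑Sf : Set (HeightOneSpectrum (𝓞 K))))
    (DSquot : DatumDualData κ γ (charModule ∅ θquot)
        (AcSelmer.bdpData (charModule ∅ θquot) p vbar) (↑Sf : Set (HeightOneSpectrum (𝓞 K))))
    (hfgS : Module.Finite (IwasawaAlgebra p) (AcSelmer.XAc (W.baseChange K) p κ vbar (↑Sf : Set (HeightOneSpectrum (𝓞 K))) γ))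
    (htorS : Module.IsTorsion (IwasawaAlgebra p) (AcSelmer.XAc (W.baseChange K) p κ vbar (↑Sf : Set (HeightOneSpectrum (𝓞 K))) γ))
    (hμS : muInvariant p (AcSelmer.XAc (W.baseChange K) p κ vbar (↑Sf : Set (HeightOneSpectrum (𝓞 K))) γ) = 0)
    (hSsub : ∀ D : DatumDualData κ γ (charModule ∅ θsub)
        (AcSelmer.bdpData (charModule ∅ θsub) p vbar) (↑Sf : Set (HeightOneSpectrum (𝓞 K))),
      Module.Finite (IwasawaAlgebra p) D.X ∧ Module.IsTorsion (IwasawaAlgebra p) D.X ∧ muInvariant p D.X = 0)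
    (hSquot : ∀ D : DatumDualData κ γ (charModule ∅ θquot)
        (AcSelmer.bdpData (charModule ∅ θquot) p vbar) (↑Sf : Set (HeightOneSpectrum (𝓞 K))),
      Module.Finite (IwasawaAlgebra p) D.X ∧ Module.IsTorsion (IwasawaAlgebra p) D.X ∧ muInvariant p D.X = 0) :
    lambdaInvariant p DSsub.X + lambdaInvariant p DSquot.X ≤
      lambdaInvariant p (AcSelmer.XAc (W.baseChange K) p κ vbar (↑Sf : Set (HeightOneSpectrum (𝓞 K))) γ) +
        (if ∀ σ : absoluteGaloisGroup K, θquot σ = 1 then 1 else 0) := by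
  have hpv : ((p : ℕ) : 𝓞 K) ∈ v.asIdeal := IndexPlumbingNrVsStrict.natCast_mem_asIdeal_of_forall_norm_iff hv
  -- the x1-convention set `SN = Sf ∪ {v, v̄}` and its agreement with `Sf` off `p`
  set SN : Finset (HeightOneSpectrum (𝓞 K)) := insert v (insert vbar Sf) with hSNdef
  have hSp : ∀ w : HeightOneSpectrum (𝓞 K), ((p : ℕ) : 𝓞 K) ∈ w.asIdeal →
      w ∈ (↑(insert v (insert vbar Sf)) : Set (HeightOneSpectrum (𝓞 K))) :=
    AcTwistDeformationResidualPair.mem_insert_insert_of_natCast_mem hK hpv hvbar hne Sf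
  have hSN : ∀ w : HeightOneSpectrum (𝓞 K), w ∈ SN ↔ ((W.conductorNorm ℤ : ℤ) : 𝓞 K) ∈ w.asIdeal := by
    intro w
    constructor
    · intro hw
      rw [hSNdef, Finset.mem_insert, Finset.mem_insert] at hw
      rcases hw with rfl | rfl | hw
      · exact conductorNorm_mem_of_natCast_mem W hsplitred hpv
      · exact conductorNorm_mem_of_natCast_mem W hsplitred hvbar
      · exact ((hSf w).mp hw).1
    · intro hN
      by_cases hpw : ((p : ℕ) : 𝓞 K) ∈ w.asIdeal
      · have h := hSp w hpw
        rw [Finset.mem_coe] at h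
        rw [hSNdef]; exact h
      · rw [hSNdef, Finset.mem_insert, Finset.mem_insert]
        exact Or.inr (Or.inr ((hSf w).mpr ⟨hN, hpw⟩))
  have hoff : ∀ w : HeightOneSpectrum (𝓞 K), ((p : ℕ) : 𝓞 K) ∉ w.asIdeal →
      (w ∈ (↑Sf : Set (HeightOneSpectrum (𝓞 K))) ↔ w ∈ (↑SN : Set (HeightOneSpectrum (𝓞 K)))) := by
    intro w hpw
    rw [Finset.mem_coe, Finset.mem_coe, hSNdef, Finset.mem_insert, Finset.mem_insert]
    constructor
    · exact fun hw ↦ Or.inr (Or.inr hw)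
    · rintro (rfl | rfl | hw)
      · exact absurd hpv hpw
      · exact absurd hvbar hpw
      · exact hw
  have hoff' : ∀ w : HeightOneSpectrum (𝓞 K), ((p : ℕ) : 𝓞 K) ∉ w.asIdeal →
      (w ∈ (↑SN : Set (HeightOneSpectrum (𝓞 K))) ↔ w ∈ (↑Sf : Set (HeightOneSpectrum (𝓞 K)))) :=
    fun w hpw ↦ (hoff w hpw).symm
  -- transfer of the curve-side invariants `Sf → SN`
  haveI hEK : (W.baseChange K).IsElliptic := inferInstanceAs (W.map (algebraMap ℚ K)).IsElliptic
  have hsel : AcSelmer.selmerAc (W.baseChange K) p κ vbar (↑Sf : Set (HeightOneSpectrum (𝓞 K))) =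
      AcSelmer.selmerAc (W.baseChange K) p κ vbar (↑SN : Set (HeightOneSpectrum (𝓞 K))) :=
    selmerAc_congr_offP κ (W.baseChange K) vbar hoff
  obtain ⟨hfgT, htorT, hμT, hlamT⟩ := xAc_invariants_congr (W.baseChange K) p κ vbar γ hsel
  have hfgS' := hfgT hfgS
  have htorS' := htorT htorS
  have hμS' : muInvariant p (AcSelmer.XAc (W.baseChange K) p κ vbar (↑SN : Set (HeightOneSpectrum (𝓞 K))) γ) = 0 := by
    rw [← hμT]; exact hμS
  -- transfer of the character-side `∀ D` clauses `Sf → SN`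
  have hSsub' : ∀ D : DatumDualData κ γ (charModule ∅ θsub)
      (AcSelmer.bdpData (charModule ∅ θsub) p vbar) (↑SN : Set (HeightOneSpectrum (𝓞 K))),
      Module.Finite (IwasawaAlgebra p) D.X ∧ Module.IsTorsion (IwasawaAlgebra p) D.X ∧ muInvariant p D.X = 0 := fun D ↦
    prop_datumDualData_congr_offP κ (AcSelmer.bdpData (charModule ∅ θsub) p vbar) hoff'
      (fun X _ _ ↦ Module.Finite (IwasawaAlgebra p) X ∧ Module.IsTorsion (IwasawaAlgebra p) X ∧ muInvariant p X = 0) hSsub D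
  have hSquot' : ∀ D : DatumDualData κ γ (charModule ∅ θquot)
      (AcSelmer.bdpData (charModule ∅ θquot) p vbar) (↑SN : Set (HeightOneSpectrum (𝓞 K))),
      Module.Finite (IwasawaAlgebra p) D.X ∧ Module.IsTorsion (IwasawaAlgebra p) D.X ∧ muInvariant p D.X = 0 := fun D ↦
    prop_datumDualData_congr_offP κ (AcSelmer.bdpData (charModule ∅ θquot) p vbar) hoff'
      (fun X _ _ ↦ Module.Finite (IwasawaAlgebra p) X ∧ Module.IsTorsion (IwasawaAlgebra p) X ∧ muInvariant p X = 0) hSquot D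
  -- the `SN`-statement for every pair of `SN`-dual data
  have hmain : ∀ (D₁ : DatumDualData κ γ (charModule ∅ θsub)
        (AcSelmer.bdpData (charModule ∅ θsub) p vbar) (↑SN : Set (HeightOneSpectrum (𝓞 K))))
      (D₃ : DatumDualData κ γ (charModule ∅ θquot)
        (AcSelmer.bdpData (charModule ∅ θquot) p vbar) (↑SN : Set (HeightOneSpectrum (𝓞 K)))),
      lambdaInvariant p D₁.X + lambdaInvariant p D₃.X ≤
        lambdaInvariant p (AcSelmer.XAc (W.baseChange K) p κ vbar (↑Sf : Set (HeightOneSpectrum (𝓞 K))) γ) +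
          (if ∀ σ : absoluteGaloisGroup K, θquot σ = 1 then 1 else 0) := by
    intro D₁ D₃
    rw [hlamT]
    exact SplitMultLambdaLE.lambdaInvariant_add_le_of_split h263 h41 h42 h5A h32 W p hp hsplitred K hK hCD2 hH hsplit htor ι v vbar
      hv hvbar hne κ hκ γ θsub θquot hpair hramI SN hSN D₁ D₃ hfgS' htorS' hμS' hSsub' hSquot'
  -- transfer of the conclusion `SN → Sf` (twice)
  exact prop_datumDualData_congr_offP κ (AcSelmer.bdpData (charModule ∅ θsub) p vbar) hoff
    (fun X _ _ ↦ lambdaInvariant p X + lambdaInvariant p DSquot.X ≤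
      lambdaInvariant p (AcSelmer.XAc (W.baseChange K) p κ vbar (↑Sf : Set (HeightOneSpectrum (𝓞 K))) γ) +
        (if ∀ σ : absoluteGaloisGroup K, θquot σ = 1 then 1 else 0))
    (fun D₁ ↦ prop_datumDualData_congr_offP κ (AcSelmer.bdpData (charModule ∅ θquot) p vbar) hoff
      (fun Y _ _ ↦ lambdaInvariant p D₁.X + lambdaInvariant p Y ≤
        lambdaInvariant p (AcSelmer.XAc (W.baseChange K) p κ vbar (↑Sf : Set (HeightOneSpectrum (𝓞 K))) γ) +
          (if ∀ σ : absoluteGaloisGroup K, θquot σ = 1 then 1 else 0))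
      (fun D₃ ↦ hmain D₁ D₃) DSquot) DSsub

end LineB1

end Summit.BirchSwinnertonDyer.BirchSwinnertonDyer.Theorems.SplitMultSfTransfer

end
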